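import Summits.Ventures.ResidMod.Mod2A5bVerdict
import Summits.Ventures.ResidMod.VerdictsFull
import Summits.Ventures.ResidMod.InstanceKit
import HarnessLib

/-!
# Venture ResidMod — census row, flag T-2: the Jacobian of the genus-2 curve 1091.a.1091.1 is modular,
# GIVEN Boxer–Calegari–Gee–Pilloni 2025 Thm. 8.3.2 and the cell's certificate for this curve

HONEST FRAMING. A per-surface INSTANCE of the cell's mod-2 verdict (`modular_of_mod2EulerCertificate`),
NOT a printed theorem about this curve and NOT an unconditional modularity proof: it is the implication
"BCGP 2025 Thm. 8.3.2 (`h832`, the tree's named fact) ∧ the certificate data below ⟹ `A` modular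
(almost-everywhere `GL₄` form)", with every datum about `A` a binder. The curve (LMFDB label
`1091.a.1091.1`, conductor `1091`, prime):

  `X : y² + (x² + x + 1) y = x⁵ − 2x³ − x²`   (`deg(4f + h²) = 5`: a rational Weierstrass point at `∞`).

`A` stands for `Jac(X)`; the tree has no Jacobians, so "`A = Jac(X)`" is carried by the binders: the
Weierstrass `2`-torsion frame `F` (Galois acts on `A[2]` through the permutations of the five finite
Weierstrass points, BCGP §8.1) and the three Euler factors (the cell's engines, exact point counts
`#X(𝔽_q), #X(𝔽_{q²})`: engine-2 census pass 1, `engine/eng2/out/census_pass1/summary_pass1_B256.tsv` row `1091.a.1091.1`: `L_2 = [1,2,3,4,4]`, `L_3 = [1,3,6,9,9]`, `ordinary_at_3 = false`, mod-2 image of order `120` with Weierstrass pattern `5+1`; `L₅` from the seat's stdlib counter `work/curve_quick.py`, which reproduces the engine's `L₂, L₃`):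
  `L₂(A,T) = 1 + 2T + 3T² + 4T³ + 4T⁴`   (`#X(𝔽₂) = 5`, `#X(𝔽₄) = 7`; `(a₂,b₂) = (−2,3)`: `b₂` odd ⟹
      ordinary at `2`; `Q₂(x) = x⁴+2x³+3x²+4x+4` is not a square ⟹ `2`-distinguished — the printed
      criterion of BCGP §9.1, slot `hord` below, NOT derived in the tree),
  `L₃(A,T) = 1 + 3T + 6T² + 9T³ + 9T⁴`   (`(a₃,b₃) = (−3,6)`: odd/even ⟹ a Frobenius of order `3` or `6`),
  `L₅(A,T) = 1 + 3T + 5T² + 15T³ + 25T⁴` (`(a₅,b₅) = (−3,5)`: odd/odd ⟹ a Frobenius of order `5`);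
the `2`-division quintic has LMFDB field label `5.1.17456.1` (ONE real place ⟹ complex conjugation
moves four Weierstrass points, slot `hcc`; Galois group `S₅`, consistent with GAL5 derived here in the
kernel from `L₃, L₅`). NOT COVERED IN PRINT by BCGP 2025 Thm. 1.1.1 (`b₃ = 6 ≡ 0 mod 3`: `A` is not
ordinary at `3`), i.e. this row is in the cell's class "T-2 ∖ T-L" (PLAN A3, N-1). What the kernel
checks: the parities, the primes, and the composition `modular_of_mod2EulerCertificate` (GAL5 from
`L₃, L₅`; the semistable clause from `L₂`; hypotheses (1)–(2) of Thm. 8.3.2 from the frame).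

References: [BoxerCalegariGeePilloni2025] arXiv:2502.20645 Thm. 8.3.2, §8.1, §9.1 (Def. 9.1.2);
[LMFDB] genus-2 curve 1091.a.1091.1 (equation, `two_torsion_field`, `non_maximal_primes = [2,7]`,
mod-2 image `2.6.1`); cell HOME `run/shared/lean/pub/pub-residmod/`.
-/

noncomputable section

namespace Summit.Ventures.ResidMod.Instances

open Field IsDedekindDomain Polynomial
open scoped NumberField
open Literature.NumberTheory.GaloisRepresentations Literature.NumberTheory.Automorphic
open Literature.NumberTheory.Automorphic.Paramodular
open Literature.NumberTheory.DiophantineGeometry Literature.NumberTheory.FaltingsSerre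
open Literature.AlgebraicGeometry.Motives (AbelianVariety)
open Summit.Ventures.ResidMod

/-- **Census row 1091.a.1091.1 (flag T-2): modular GIVEN Thm. 8.3.2 and the certificate.**  Binders:
`h832` (BCGP 2025 Thm. 8.3.2, named fact); `A`, `hA` (an abelian surface — "`Jac(X)`"); `F` (Weierstrass
`2`-torsion frame); `hL5`, `hL3`, `hL2` (the Euler factors `L₅ = 1+3T+5T²+15T³+25T⁴`,
`L₃ = 1+3T+6T²+9T³+9T⁴`, `L₂ = 1+2T+3T²+4T³+4T⁴`); `hcc` (one real Weierstrass point among the five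
finite ones); `hord` (ordinary and `2`-distinguished at `2`, Def. 1.8.8 — certified from `L₂` by the
printed criterion of §9.1, not in the tree). Conclusion: every framed dual of every `V_p(A)` is
`IsAutomorphicAE`. The parities `(a₅,b₅) = (−3,5)` odd/odd and `(a₃,b₃) = (−3,6)` odd/even are decided
in the kernel. [cite: BoxerCalegariGeePilloni2025, Thm. 8.3.2; §8.1; Def. 9.1.2] -/
theorem modular_1091a (h832 : bcgp_residuallyA5b_modular_abelianSurface)
    (A : AbelianVariety ℚ) (hA : A.dim = 2) (F : WeierstrassTwoTorsionFrame A)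
    (hL5 : A.HasGoodEulerFactorAt 5 ((lPolynomialOfSurface 5 (-3) 5).map (Int.castRingHom ℚ)))
    (hL3 : A.HasGoodEulerFactorAt 3 ((lPolynomialOfSurface 3 (-3) 6).map (Int.castRingHom ℚ)))
    (hL2 : A.HasGoodEulerFactorAt 2 ((lPolynomialOfSurface 2 (-2) 3).map (Int.castRingHom ℚ)))
    (hcc : ∀ c : absoluteGaloisGroup ℚ, IsComplexConjugation (algebraMap ℚ ℝ) c →
      (F.perm c).support.card = 4)
    (hord : ∀ (b₂ : Module.Basis (Fin 4) ℚ_[2] (A.rationalTateModule 2))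
        (r₂ : FramedGaloisRep ℚ (PadicAlgCl 2) 4),
        (∀ g : absoluteGaloisGroup ℚ,
          (r₂ g).val =
            ((LinearMap.toMatrix b₂ b₂ (A.rationalTateRep 2 g⁻¹)).map
              (algebraMap ℚ_[2] (PadicAlgCl 2))).transpose) →
        ∀ v : HeightOneSpectrum (𝓞 ℚ), ((2 : ℕ) : 𝓞 ℚ) ∈ v.asIdeal →
          r₂.IsOrdinaryPDistinguishedAt v) :
    ∀ (p : ℕ) [Fact p.Prime] (b : Module.Basis (Fin 4) ℚ_[p] (A.rationalTateModule p))
      (r : FramedGaloisRep ℚ (PadicAlgCl p) 4),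
      (∀ g : absoluteGaloisGroup ℚ,
        (r g).val =
          ((LinearMap.toMatrix b b (A.rationalTateRep p g⁻¹)).map
            (algebraMap ℚ_[p] (PadicAlgCl p))).transpose) →
      ∀ (hcpt : isCompact_glFiniteIntegralLevel 4 ℚ) (ι : PadicAlgCl p ≃+* ℂ),
        IsAutomorphicAE ι hcpt r :=
  modular_of_mod2EulerCertificate h832 A hA F (by norm_num) (by norm_num) hL5
    (by decide) (by decide) (by norm_num) (by norm_num) hL3 (by decide) (by decide) hcc hL2 hord

/-- The numeric side conditions of this row, for the record: `L₂`'s middle coefficient `b₂ = 3` is odd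
(ordinary at `2`) and `Q₂(x) = x⁴ + 2x³ + 3x² + 4x + 4 ≠ (x² + x + 2)² = x⁴ + 2x³ + 5x² + 4x + 4`, the
only candidate square (so `Q₂` is not a square: `2`-distinguished by the printed criterion); `b₃ = 6` is
divisible by `3` (NOT ordinary at `3`: outside BCGP 2025 Thm. 1.1.1). [cite: BoxerCalegariGeePilloni2025, Def. 9.1.2 and §10.1] -/
example : Odd (3 : ℤ) ∧ ((X ^ 2 + X + 2) ^ 2 : Polynomial ℤ) = X ^ 4 + 2 * X ^ 3 + 5 * X ^ 2 + 4 * X + 4 ∧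
    (3 : ℤ) ∣ 6 := by
  refine ⟨by decide, by ring, by norm_num⟩

/-- DIST0(2) for 1091.a: `L₂ = 1 + 2T + 3T² + 4T³ + 4T⁴` is separable over `ℚ` — Bézout identity
`(70 − 108T + 48T²)·L₂ + (−1 − 13T + 24T² − 12T³)·L₂' = 68`, checked by `ring`. With ORD(2) this is
"`Q₂` not a square", the printed `2`-distinguished criterion. [cite: BoxerCalegariGeePilloni2025, Def. 9.1.2] -/
theorem separable_L2_1091a : ((lPolynomialOfSurface 2 (-2) 3).map (Int.castRingHom ℚ)).Separable := by
  apply separable_of_intBezout (U := 70 - 108 * X + 48 * X ^ 2)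
    (V := -1 - 13 * X + 24 * X ^ 2 - 12 * X ^ 3) (N := 68) (by norm_num)
  rw [derivative_map_lPolynomialOfSurface_eq, map_lPolynomialOfSurface_eq]
  push_cast
  ring

/-- **Census row 1091.a.1091.1 (flag T-2), FULL CHAIN: modular GIVEN the three named facts and the
certificate.**  As `modular_1091a`, but the local slot at `2` is DERIVED: ordinary at `2` from
`b₂ = 3` odd (Deligne's criterion `hDel`), `2`-distinguished from `separable_L2_1091a` (BCGP Def. 9.1.2,
`hB2`), given good reduction at `2` as the scheme-theoretic binder `hgood₂` (`1091` is prime). Binders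
left: `F` (Weierstrass frame), `hcc` (one real Weierstrass point), `hgood₂`; the Euler factors
`L₅ = (−3,5)`, `L₃ = (−3,6)`, `L₂ = (−2,3)`; and the facts `h832`, `hB2`, `hDel`.
[cite: BoxerCalegariGeePilloni2025, Thm. 8.3.2, Def. 9.1.2, §8.1] [cite: Deligne1969OrdinaryAV, §2] -/
theorem modular_1091a_full (h832 : bcgp_residuallyA5b_modular_abelianSurface)
    (hB2 : bcgp2025_goodOrdinary_pDistinguished_abelianSurface)
    (hDel : deligne_hasGoodOrdinaryReductionAt_iff_not_dvd_middleCoeff)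
    (A : AbelianVariety ℚ) (hA : A.dim = 2) (F : WeierstrassTwoTorsionFrame A)
    (hL5 : A.HasGoodEulerFactorAt 5 ((lPolynomialOfSurface 5 (-3) 5).map (Int.castRingHom ℚ)))
    (hL3 : A.HasGoodEulerFactorAt 3 ((lPolynomialOfSurface 3 (-3) 6).map (Int.castRingHom ℚ)))
    (hL2 : A.HasGoodEulerFactorAt 2 ((lPolynomialOfSurface 2 (-2) 3).map (Int.castRingHom ℚ)))
    (hcc : ∀ c : absoluteGaloisGroup ℚ, IsComplexConjugation (algebraMap ℚ ℝ) c →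
      (F.perm c).support.card = 4)
    (hgood₂ : ∀ v : HeightOneSpectrum (𝓞 ℚ), ((2 : ℕ) : 𝓞 ℚ) ∈ v.asIdeal →
      Literature.AlgebraicGeometry.Motives.HasGoodReductionAt A.X A.dim v) :
    ∀ (p : ℕ) [Fact p.Prime] (b : Module.Basis (Fin 4) ℚ_[p] (A.rationalTateModule p))
      (r : FramedGaloisRep ℚ (PadicAlgCl p) 4),
      (∀ g : absoluteGaloisGroup ℚ,
        (r g).val =
          ((LinearMap.toMatrix b b (A.rationalTateRep p g⁻¹)).map
            (algebraMap ℚ_[p] (PadicAlgCl p))).transpose) →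
      ∀ (hcpt : isCompact_glFiniteIntegralLevel 4 ℚ) (ι : PadicAlgCl p ≃+* ℂ),
        IsAutomorphicAE ι hcpt r :=
  modular_of_mod2Row h832 hB2 hDel A hA F (by norm_num) (by norm_num) hL5 (by decide) (by decide)
    (by norm_num) (by norm_num) hL3 (by decide) (by decide) hcc hL2 (by decide) separable_L2_1091a hgood₂

end Summit.Ventures.ResidMod.Instances

end
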